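import Literature.NumberTheory.Transcendental.RoySmallValueLiouville
import Mathlib.FieldTheory.Galois.Basic
import Mathlib.Algebra.Algebra.Hom.Rat
import Mathlib.NumberTheory.NumberField.InfinitePlace.Embeddings
import HarnessLib

/-!
# Roy's small value estimate for `𝔾ₐ × 𝔾ₘ` — Galois orbits of points and Liouville's inequality on an orbit

Topic `Literature/NumberTheory/Transcendental`. Part of the formalisation of the proof of Roy 2013,
Theorem 1.1 (named fact `roy2013_thm_1_1`, `RoySmallValueEstimates.lean`), seat B. Roy works
with zero-dimensional subvarieties `Z` of `ℙ²_ℚ` ("the points of `Z(ℂ)` are conjugate over `ℚ`",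
proof of Prop. 6.4; `deg(Z)` points, height `h(Z)`; Liouville's inequality (2.2) of Prop. 2.3).
In this development such a `Z` is a GALOIS ORBIT of a point `a ∈ K³` under `Gal(K/ℚ)` for a
Galois number field `K` equipped with a fixed embedding `ι₀ : K → ℂ`, and this file supplies the
bookkeeping between the three ways of summing over `Z`: over the embeddings `K → ℂ`, over the
automorphisms of `K`, and over the points of the orbit.

* `exists_algEquiv_of_embedding`, `embEquiv` — for `K/ℚ` Galois, `σ ↦ ι₀ ∘ σ` is a bijection
  from `Gal(K/ℚ)` onto the embeddings `K →+* ℂ` (`AlgHom.restrictNormal`);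
* `orbitF a` — the orbit of `a : Fin 3 → K` as a `Finset`; `card_fiber_eq_card_stabilizer`,
  `card_aut_eq_card_orbitF_mul` (`|Gal| = |orbit| · |Stab|`), `prod_aut_eq_prod_orbitF_pow`
  (`∏_σ g(σa) = (∏_{b ∈ orbit} g(b))^{|Stab|}`);
* `aeval_smul_int` — `P(σ a) = σ(P(a))` for `P ∈ ℤ[X]`;
* **`orbit_liouville`** — Liouville's inequality on an orbit `O`, per-point heights:
  for `P ∈ ℤ[X]_D` non-vanishing at a point of `O`,
  `-(D/[K:ℚ]) ∑_{a ∈ O} h_K(a) ≤ ∑_{b ∈ O} log (|ι₀(P(b))| / ‖ι₀ ∘ b‖^D)` (Roy's (2.2) for `Z = O`,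
  with `D h(Z)` realised as `(D/[K:ℚ]) ∑_{a ∈ O} h_K(a)` and no `7 log 3 · D deg Z` slack).

Everything is proved; the one definition (`orbitF`) has a body; no named facts.

## References

* [Roy2013] D. Roy, *A small value estimate for 𝔾ₐ × 𝔾ₘ*, Mathematika 59 (2013), 333–363
  (arXiv:1301.0663), §2 Prop. 2.3 (2.2); §6 proof of Prop. 6.4 ("conjugate over `ℚ`"); §7 Step 4.
-/

noncomputable section

open MvPolynomial NumberField Height Finset

namespace Literature.NumberTheory.Transcendental

namespace Roy2013

variable {K : Type*} [Field K] [NumberField K]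

/-! ### Embeddings and automorphisms -/

/-- For `K/ℚ` Galois with a fixed embedding `ι₀ : K → ℂ`, every embedding is `ι₀ ∘ σ` for an
automorphism `σ`. [folklore] -/
theorem exists_algEquiv_of_embedding [IsGalois ℚ K] (ι₀ σ : K →+* ℂ) :
    ∃ τ : K ≃ₐ[ℚ] K, ∀ x, σ x = ι₀ (τ x) := by
  letI : Algebra K ℂ := ι₀.toAlgebra
  haveI : IsScalarTower ℚ K ℂ := IsScalarTower.of_algebraMap_eq fun q => by
    rw [RingHom.algebraMap_toAlgebra, eq_ratCast, eq_ratCast, map_ratCast]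
  refine ⟨(σ.toRatAlgHom).restrictNormal' K, fun x => ?_⟩
  have h := AlgHom.restrictNormal_commutes (σ.toRatAlgHom) K x
  rw [Algebra.algebraMap_self, RingHom.id_apply] at h
  -- `h : ι₀ (restrictNormal x) = σ x`
  exact h.symm

/-- `σ ↦ ι₀ ∘ σ` is injective. [folklore] -/
theorem comp_algEquiv_injective (ι₀ : K →+* ℂ) :
    Function.Injective fun τ : K ≃ₐ[ℚ] K => ι₀.comp (τ : K →+* K) := by
  intro τ₁ τ₂ h
  ext x
  exact ι₀.injective (by simpa using RingHom.congr_fun h x)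

/-- **Automorphisms `≃` embeddings** for a Galois number field with a fixed embedding.
[folklore] -/
theorem comp_algEquiv_bijective [IsGalois ℚ K] (ι₀ : K →+* ℂ) :
    Function.Bijective fun τ : K ≃ₐ[ℚ] K => ι₀.comp (τ : K →+* K) := by
  refine ⟨comp_algEquiv_injective ι₀, fun σ => ?_⟩
  obtain ⟨τ, hτ⟩ := exists_algEquiv_of_embedding ι₀ σ
  exact ⟨τ, RingHom.ext fun x => (hτ x).symm⟩

/-- The bijection `Gal(K/ℚ) ≃ (K →+* ℂ)`, `τ ↦ ι₀ ∘ τ`. [folklore] -/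
def embEquiv [IsGalois ℚ K] (ι₀ : K →+* ℂ) : (K ≃ₐ[ℚ] K) ≃ (K →+* ℂ) :=
  Equiv.ofBijective _ (comp_algEquiv_bijective ι₀)

/-- `embEquiv ι₀ τ = ι₀ ∘ τ`. [folklore] -/
theorem embEquiv_apply [IsGalois ℚ K] (ι₀ : K →+* ℂ) (τ : K ≃ₐ[ℚ] K) (x : K) :
    embEquiv ι₀ τ x = ι₀ (τ x) := rfl

/-- **Sums over embeddings are sums over automorphisms.** [folklore] -/
theorem prod_embeddings_eq_prod_aut [IsGalois ℚ K] (ι₀ : K →+* ℂ) {M : Type*} [CommMonoid M]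
    (f : (K →+* ℂ) → M) : ∏ σ : K →+* ℂ, f σ = ∏ τ : K ≃ₐ[ℚ] K, f (ι₀.comp (τ : K →+* K)) :=
  (Fintype.prod_equiv (embEquiv ι₀) _ _ fun _ => rfl).symm

/-- `|Gal(K/ℚ)| = [K:ℚ]`. [folklore] -/
theorem card_aut [IsGalois ℚ K] : Fintype.card (K ≃ₐ[ℚ] K) = Module.finrank ℚ K := by
  rw [← Nat.card_eq_fintype_card]; exact IsGalois.card_aut_eq_finrank ℚ K

/-! ### Orbits of points -/

variable {n : ℕ} [DecidableEq K]

/-- The orbit of `a ∈ Kⁿ` under `Gal(K/ℚ)` (coordinatewise action), as a `Finset`.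
[cite: Roy2013, §6, proof of Prop. 6.4 ("the points of `Z(ℂ)` are conjugate over `ℚ`")] -/
def orbitF (a : Fin n → K) : Finset (Fin n → K) :=
  (univ : Finset (K ≃ₐ[ℚ] K)).image fun τ => τ • a

/-- `a ∈ orbit a`. [folklore] -/
theorem mem_orbitF_self (a : Fin n → K) : a ∈ orbitF a :=
  mem_image.mpr ⟨1, mem_univ _, one_smul _ a⟩

/-- Membership in the orbit. [folklore] -/
theorem mem_orbitF_iff {a b : Fin n → K} : b ∈ orbitF a ↔ ∃ τ : K ≃ₐ[ℚ] K, τ • a = b := by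
  simp [orbitF]

/-- Orbits are invariant. [folklore] -/
theorem orbitF_smul (τ : K ≃ₐ[ℚ] K) (a : Fin n → K) : orbitF (τ • a) = orbitF a := by
  ext b
  simp only [mem_orbitF_iff]
  constructor
  · rintro ⟨ρ, rfl⟩; exact ⟨ρ * τ, mul_smul _ _ _⟩
  · rintro ⟨ρ, rfl⟩; exact ⟨ρ * τ⁻¹, by rw [mul_smul, inv_smul_smul]⟩

/-- Points of an orbit have the same orbit. [folklore] -/
theorem orbitF_eq_of_mem {a b : Fin n → K} (h : b ∈ orbitF a) : orbitF b = orbitF a := by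
  obtain ⟨τ, rfl⟩ := mem_orbitF_iff.mp h
  exact orbitF_smul τ a

/-- **The fibres of `τ ↦ τ • a` over the orbit are cosets of the stabiliser.** [folklore] -/
theorem card_fiber_eq_card_stabilizer (a : Fin n → K) {b : Fin n → K} (hb : b ∈ orbitF a) :
    (univ.filter fun τ : K ≃ₐ[ℚ] K => τ • a = b).card =
      Nat.card (MulAction.stabilizer (K ≃ₐ[ℚ] K) a) := by
  obtain ⟨τ₀, rfl⟩ := mem_orbitF_iff.mp hb
  rw [← Fintype.card_coe, ← Nat.card_eq_fintype_card]
  refine Nat.card_congr ⟨fun τ => ⟨τ₀⁻¹ * τ.1, ?_⟩, fun σ => ⟨τ₀ * σ.1, ?_⟩, ?_, ?_⟩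
  · have hτ : τ.1 • a = τ₀ • a := (mem_filter.mp τ.2).2
    rw [MulAction.mem_stabilizer_iff, mul_smul, hτ, inv_smul_smul]
  · rw [mem_filter]
    refine ⟨mem_univ _, ?_⟩
    rw [mul_smul, σ.2]
  · intro τ; ext1; simp
  · intro σ; ext1; simp

/-- **`∏_{τ ∈ Gal} g(τ • a) = (∏_{b ∈ orbit a} g b)^{|Stab a|}`.** [folklore] -/
theorem prod_aut_eq_prod_orbitF_pow (a : Fin n → K) {M : Type*} [CommMonoid M]
    (g : (Fin n → K) → M) :
    ∏ τ : K ≃ₐ[ℚ] K, g (τ • a) =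
      (∏ b ∈ orbitF a, g b) ^ Nat.card (MulAction.stabilizer (K ≃ₐ[ℚ] K) a) := by
  rw [← prod_fiberwise_of_maps_to (s := (univ : Finset (K ≃ₐ[ℚ] K))) (t := orbitF a)
    (g := fun τ : K ≃ₐ[ℚ] K => τ • a) (fun τ _ => mem_image_of_mem (fun τ => τ • a) (mem_univ τ))
    (fun τ => g (τ • a)), ← prod_pow]
  refine prod_congr rfl fun b hb => ?_
  have hconst : ∀ τ ∈ univ.filter (fun τ : K ≃ₐ[ℚ] K => τ • a = b), g (τ • a) = g b :=
    fun τ hτ => by rw [(mem_filter.mp hτ).2]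
  rw [prod_congr rfl hconst, prod_const, card_fiber_eq_card_stabilizer a hb]

/-- **`|Gal(K/ℚ)| = |orbit a| · |Stab a|`.** [folklore] -/
theorem card_aut_eq_card_orbitF_mul (a : Fin n → K) :
    Fintype.card (K ≃ₐ[ℚ] K) = (orbitF a).card * Nat.card (MulAction.stabilizer (K ≃ₐ[ℚ] K) a) := by
  have h := card_eq_sum_card_fiberwise (s := (univ : Finset (K ≃ₐ[ℚ] K))) (t := orbitF a)
    (f := fun τ : K ≃ₐ[ℚ] K => τ • a) (fun τ _ => mem_image_of_mem (fun τ => τ • a) (mem_univ τ))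
  rw [card_univ] at h
  rw [h, sum_congr rfl fun b hb => card_fiber_eq_card_stabilizer a hb, sum_const, smul_eq_mul]

/-! ### Values of integer polynomials at conjugate points -/

omit [DecidableEq K] in
/-- `P(τ • a) = τ (P(a))` for `P ∈ ℤ[X]`. [folklore] -/
theorem aeval_smul_int (τ : K ≃ₐ[ℚ] K) (a : Fin n → K) (P : MvPolynomial (Fin n) ℤ) :
    aeval (τ • a) P = τ (aeval a P) := by
  induction P using MvPolynomial.induction_on with
  | C k => simp
  | add p q hp hq => rw [map_add, map_add, map_add, hp, hq]
  | mul_X p i hp => rw [map_mul, map_mul, map_mul, hp, aeval_X, aeval_X]; rfl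

/-! ### Liouville's inequality on an orbit -/

/-- **Liouville's inequality on a Galois orbit, per-point heights.** Let `K/ℚ` be Galois with a
fixed embedding `ι₀`, `a ∈ Kⁿ ∖ {0}`, `O` its orbit, and `P ∈ ℤ[X]` homogeneous of degree `D` with
`P(a) ≠ 0`. Then
`1 ≤ (∏_{c ∈ O} H_K(c))^{D} · (∏_{b ∈ O} |ι₀ P(b)| / ‖ι₀ ∘ b‖^D)^{[K:ℚ]}`, the multiplicative form
of `-(D/[K:ℚ]) ∑_{c ∈ O} h_K(c) ≤ ∑_{b ∈ O} log(|ι₀P(b)|/‖ι₀ ∘ b‖^D)`: Roy's (2.2) for the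
zero-dimensional `Z = O` with `D h(Z)` realised as `(D/[K:ℚ]) ∑_{c ∈ O} h_K(c)`.
[cite: Roy2013, Prop. 2.3 (2.2); §7 Step 4] -/
theorem orbit_liouville [IsGalois ℚ K] (ι₀ : K →+* ℂ) {P : MvPolynomial (Fin n) ℤ} {D : ℕ}
    (hP : P.IsHomogeneous D) {a : Fin n → K} (ha0 : a ≠ 0) (ha : aeval a P ≠ 0) :
    1 ≤ (∏ c ∈ orbitF a, mulHeight c) ^ D *
      (∏ b ∈ orbitF a, ‖ι₀ (aeval b P)‖ / ‖(ι₀ ∘ b : Fin n → ℂ)‖ ^ D) ^ Module.finrank ℚ K := by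
  set s : ℕ := Nat.card (MulAction.stabilizer (K ≃ₐ[ℚ] K) a) with hs
  set O := orbitF a with hO
  set g : (Fin n → K) → ℝ := fun b => ‖ι₀ (aeval b P)‖ / ‖(ι₀ ∘ b : Fin n → ℂ)‖ ^ D with hg
  -- the stabilisers of the points of the orbit have the same size
  have hstab : ∀ τ₀ : K ≃ₐ[ℚ] K, Nat.card (MulAction.stabilizer (K ≃ₐ[ℚ] K) (τ₀ • a)) = s := by
    intro τ₀
    have h1 := card_aut_eq_card_orbitF_mul (τ₀ • a)
    have h2 := card_aut_eq_card_orbitF_mul a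
    rw [orbitF_smul] at h1
    have hpos : 0 < (orbitF a).card := card_pos.mpr ⟨a, mem_orbitF_self a⟩
    exact Nat.eq_of_mul_eq_mul_left hpos (h1.symm.trans h2)
  -- Liouville at each point `c` of the orbit, rewritten over the orbit
  have hpt : ∀ c ∈ O, 1 ≤ mulHeight c ^ D * (∏ b ∈ O, g b) ^ s := by
    intro c hc
    obtain ⟨τ₀, rfl⟩ := mem_orbitF_iff.mp hc
    have hc0 : τ₀ • a ≠ 0 := fun h => ha0 (by
      have := congr_arg (fun x => τ₀⁻¹ • x) h
      simpa using this)
    have hcP : aeval (τ₀ • a) P ≠ 0 := by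
      rw [aeval_smul_int]; exact (map_ne_zero τ₀).mpr ha
    have h := one_le_mulHeight_pow_mul_prod hP hc0 hcP
    rw [prod_embeddings_eq_prod_aut ι₀] at h
    have hrw : ∀ τ : K ≃ₐ[ℚ] K,
        ‖(ι₀.comp (τ : K →+* K)) (aeval (τ₀ • a) P)‖ /
          ‖((ι₀.comp (τ : K →+* K)) ∘ (τ₀ • a) : Fin n → ℂ)‖ ^ D = g (τ • (τ₀ • a)) := by
      intro τ
      have h1 : (ι₀.comp (τ : K →+* K)) (aeval (τ₀ • a) P) = ι₀ (aeval (τ • (τ₀ • a)) P) := by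
        rw [RingHom.comp_apply, aeval_smul_int τ]; rfl
      have h2 : ((ι₀.comp (τ : K →+* K)) ∘ (τ₀ • a) : Fin n → ℂ) = ι₀ ∘ (τ • (τ₀ • a)) := by
        funext i; rfl
      rw [h1, h2]
    simp_rw [hrw] at h
    rw [prod_aut_eq_prod_orbitF_pow (τ₀ • a) g, orbitF_smul, hstab] at h
    exact h
  -- multiply over the orbit
  have hcard : O.card * s = Module.finrank ℚ K := by
    rw [← card_aut, card_aut_eq_card_orbitF_mul a]
  have hprod := prod_le_prod (fun c _ => zero_le_one) hpt
  rw [prod_const_one, prod_mul_distrib, prod_const, ← pow_mul, mul_comm s, hcard, prod_pow] at hprod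
  exact hprod

end Roy2013

end Literature.NumberTheory.Transcendental
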